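import Mathlib.NumberTheory.Chebyshev
import HarnessLib

/-!
# [GenEll] Lemma 4.1 — The Existence of Primes of Prescribed Size (PROVED)

S. Mochizuki, *Arithmetic elliptic curves in general position*, Math. J. Okayama Univ. **52** (2010)
1–28 (kurims manuscript, Feb. 2009), §4 "Primes of Prescribed Size", Lemma 4.1, statement
pp. 20–21, proof p. 21 [cite: MochizukiGenEll2010, Lem 4.1 pp.20–21]; abc-iut DAG nodes
`GenEll:Lem4.1(i)`, `GenEll:Lem4.1(ii)` (the two displayed hypotheses of the lemma). Read on the page:

> **Lemma 4.1.** (The Existence of Primes of Prescribed Size) Write `ℝ'_{>0} ⊆ ℝ_{>0}` for the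
> complement in `ℝ_{>0}` of the set of prime numbers; `θ(x) := Σ_{p<x} log(p)` — where the sum is over
> prime numbers `p < x` — for `x ∈ ℝ'_{>0}`. Let `M` be a positive integer; `ε, x_ε, C_ε ∈ ℝ_{>0}` such
> that `0 < ε < 1/4`, `ε·x_ε > C_ε`, and, moreover, we have:
> (i) `(5/4)·x + C_ε > θ(x)`, for all `x ∈ ℝ'_{>0}`; `θ(x) > (1 − ε)x`, for all `x ∈ ℝ'_{>0}` such that
> `x ≥ x_ε`;
> (ii) `M·log(x) ≤ ε·x`, for all `x ∈ ℝ_{>0}` such that `x ≥ x_ε`.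
> Also, let us write `x_A := Σ_{p∈A} log(p)` for any finite set of prime numbers `A`. Then for any
> nonnegative `h ∈ ℝ` and any finite set of prime numbers `A` such that `x_A > x_ε`, there exist `M`
> distinct prime numbers `p_1, …, p_M` such that `p_j ∉ A`, and `h ≤ p_j ≤ (1 + 6ε)·x_A + 8h`, for
> `j = 1, …, M`.

## Rendering

* `θ` is Mathlib's `Chebyshev.theta x = Σ_{p ≤ x} log p`; on the paper's domain `ℝ'_{>0}` (positive
  reals that are not prime numbers) it coincides with the paper's `Σ_{p<x} log p`, so hypotheses (i)
  are stated, exactly as printed, for positive NON-PRIME `x` (`∀ p prime, (p : ℝ) ≠ x`).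
* "`M` distinct prime numbers `p_1, …, p_M` with …" = a finset `S` of primes with `S.card = M`.
* The printed side conditions `M ≥ 1`, `x_ε > 0` and "`A` consists of primes" are not needed by the
  proof and are omitted (the statement proved is the printed one with these hypotheses dropped,
  hence implies it; `A` may be any finite set of natural numbers).

## Proof

The printed proof (p. 21: "suppose that the conclusion … is false … all prime numbers `p` such that
`h ≤ p ≤ y_A` belong — with `M − 1` possible exceptions — to `A` … `x_A ≥ −M·log(y_A) − θ((1+δ)h) +
θ(y_A) ≥ … ≥ x_A + (ε·x_A − C_ε) + (4h − 5(1+δ)h/4)` — a contradiction"), with one simplification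
that Mathlib's right-continuous `θ` allows: the primes `< h` contribute at most `θ(h) ≤ 5h/4 + C_ε`
(instead of the paper's `θ((1+δ)h)`), so the device "we may assume … `y_A, (1+δ)h ∈ ℝ'_{>0}` … by
replacing `δ, h` by real numbers slightly greater" becomes the observation that (i), assumed on
non-primes only, propagates to ALL `x` because `θ` is constant on `[x, ⌊x⌋ + 1)` (`theta_le_of_nonprime`,
`theta_gt_of_nonprime`). Classical analytic number theory; no side is taken on anything disputed.
-/

namespace Literature.NumberTheory.DiophantineGeometry.GenEll

open Real Finset Nat

/-- For every real `x` there is a NON-INTEGER (hence non-prime) real `x' > x` with `⌊x'⌋₊ = ⌊x⌋₊`,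
as close to `x` as desired: the device behind "we may assume without loss of generality that
`y_A, (1+δ)h ∈ ℝ'_{>0}`" (proof of Lem. 4.1, p. 21). [cite: MochizukiGenEll2010, Lem 4.1 proof p.21] -/
private theorem exists_nonprime_gt_floor_eq {x η : ℝ} (hx : 0 ≤ x) (hη : 0 < η) :
    ∃ x' : ℝ, x < x' ∧ x' < x + η ∧ ⌊x'⌋₊ = ⌊x⌋₊ ∧ ∀ p : ℕ, p.Prime → (p : ℝ) ≠ x' := by
  -- `x' := x + t` with `t < min η (⌊x⌋+1-x)` and `x'` not an integer
  set gap : ℝ := min η ((⌊x⌋₊ : ℝ) + 1 - x) with hgap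
  have hgap0 : 0 < gap := lt_min hη (by have := Nat.lt_floor_add_one x; linarith)
  refine ⟨x + gap / 2, by linarith, by linarith [min_le_left η ((⌊x⌋₊ : ℝ) + 1 - x)], ?_, ?_⟩
  · have h1 : (⌊x⌋₊ : ℝ) ≤ x + gap / 2 := (Nat.floor_le hx).trans (by linarith)
    have h2 : x + gap / 2 < (⌊x⌋₊ : ℝ) + 1 := by
      have := min_le_right η ((⌊x⌋₊ : ℝ) + 1 - x); linarith
    exact (Nat.floor_eq_iff (by linarith)).mpr ⟨h1, h2⟩
  · intro p _ hp
    -- an integer `p` with `⌊x⌋ ≤ x < p < ⌊x⌋ + 1` cannot exist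
    have h2 : x + gap / 2 < (⌊x⌋₊ : ℝ) + 1 := by
      have := min_le_right η ((⌊x⌋₊ : ℝ) + 1 - x); linarith
    have hpx : (⌊x⌋₊ : ℝ) < p := by rw [hp]; exact lt_of_le_of_lt (Nat.floor_le hx) (by linarith)
    have hp1 : (p : ℝ) < ⌊x⌋₊ + 1 := by rw [hp]; exact h2
    have : ⌊x⌋₊ < p := by exact_mod_cast hpx
    have : p < ⌊x⌋₊ + 1 := by exact_mod_cast hp1
    omega

/-- Hypothesis (i), first half, propagated from non-primes to all `x ≥ 0`: `θ(x) ≤ (5/4)x + C`.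
[cite: MochizukiGenEll2010, Lem 4.1 (i) p.20] -/
private theorem theta_le_of_nonprime {C : ℝ}
    (hi : ∀ x : ℝ, 0 < x → (∀ p : ℕ, p.Prime → (p : ℝ) ≠ x) → Chebyshev.theta x < 5 / 4 * x + C)
    {x : ℝ} (hx : 0 ≤ x) : Chebyshev.theta x ≤ 5 / 4 * x + C := by
  by_contra hcon
  push Not at hcon
  obtain ⟨x', hxx', hx'η, hfl, hnp⟩ :=
    exists_nonprime_gt_floor_eq hx (show 0 < 4 / 5 * (Chebyshev.theta x - (5 / 4 * x + C)) by
      linarith)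
  have hθ : Chebyshev.theta x' = Chebyshev.theta x := by
    rw [Chebyshev.theta_eq_theta_coe_floor x', hfl, ← Chebyshev.theta_eq_theta_coe_floor x]
  have := hi x' (by linarith) hnp
  rw [hθ] at this
  linarith

/-- Hypothesis (i), second half, propagated from non-primes to all `x ≥ x_ε` (`x ≥ 0`, `ε ≤ 1`):
`θ(x) > (1 − ε)x`. [cite: MochizukiGenEll2010, Lem 4.1 (i) p.20] -/
private theorem theta_gt_of_nonprime {ε xε : ℝ} (hε1 : ε ≤ 1)
    (hi : ∀ x : ℝ, 0 < x → (∀ p : ℕ, p.Prime → (p : ℝ) ≠ x) → xε ≤ x →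
      (1 - ε) * x < Chebyshev.theta x)
    {x : ℝ} (hx0 : 0 ≤ x) (hx : xε ≤ x) : (1 - ε) * x < Chebyshev.theta x := by
  obtain ⟨x', hxx', -, hfl, hnp⟩ := exists_nonprime_gt_floor_eq hx0 one_pos
  have hθ : Chebyshev.theta x' = Chebyshev.theta x := by
    rw [Chebyshev.theta_eq_theta_coe_floor x', hfl, ← Chebyshev.theta_eq_theta_coe_floor x]
  have h := hi x' (by linarith) hnp (hx.trans hxx'.le)
  rw [hθ] at h
  have : (1 - ε) * x ≤ (1 - ε) * x' := mul_le_mul_of_nonneg_left hxx'.le (by linarith)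
  linarith

/-- **[GenEll] Lemma 4.1 (The Existence of Primes of Prescribed Size)**, PROVED. With
`θ = Chebyshev.theta` (`= Σ_{p<x} log p` on the non-prime `x` the hypotheses quantify over),
`0 < ε < 1/4`, `ε·x_ε > C_ε > 0`, (i) `5x/4 + C_ε > θ(x)` for all positive non-prime `x` and
`θ(x) > (1−ε)x` for all positive non-prime `x ≥ x_ε`, (ii) `M·log x ≤ ε·x` for all `x > 0` with
`x ≥ x_ε`: for every `h ≥ 0` and every finite set `A` (of primes, in print; any naturals here) with
`x_A := Σ_{p∈A} log p > x_ε` there are `M` distinct primes `p ∉ A` with `h ≤ p ≤ (1 + 6ε)·x_A + 8h`.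
[cite: MochizukiGenEll2010, Lem 4.1 pp.20–21] -/
theorem exists_primes_prescribed_size {M : ℕ} {ε xε Cε : ℝ} (hε : 0 < ε) (hε4 : ε < 1 / 4)
    (hCε : 0 < Cε) (hεx : Cε < ε * xε)
    (hi₁ : ∀ x : ℝ, 0 < x → (∀ p : ℕ, p.Prime → (p : ℝ) ≠ x) → Chebyshev.theta x < 5 / 4 * x + Cε)
    (hi₂ : ∀ x : ℝ, 0 < x → (∀ p : ℕ, p.Prime → (p : ℝ) ≠ x) → xε ≤ x →
      (1 - ε) * x < Chebyshev.theta x)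
    (hii : ∀ x : ℝ, 0 < x → xε ≤ x → (M : ℝ) * Real.log x ≤ ε * x)
    {h : ℝ} (hh : 0 ≤ h) (A : Finset ℕ) (hxA : xε < ∑ p ∈ A, Real.log p) :
    ∃ S : Finset ℕ, S.card = M ∧
      ∀ p ∈ S, p.Prime ∧ p ∉ A ∧ h ≤ p ∧ (p : ℝ) ≤ (1 + 6 * ε) * (∑ q ∈ A, Real.log q) + 8 * h := by
  classical
  set xA : ℝ := ∑ q ∈ A, Real.log q with hxA_def
  set y : ℝ := (1 + 6 * ε) * xA + 8 * h with hy
  -- positivity bookkeeping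
  have hxA0 : 0 ≤ xA := Finset.sum_nonneg fun q _ => Real.log_natCast_nonneg q
  have hxAy : xA ≤ y := by rw [hy]; nlinarith
  -- `x_ε ≥ 2`: otherwise (i) fails at a non-prime point of `[x_ε, 2)`
  have hxε2 : 2 ≤ xε := by
    by_contra hlt
    push Not at hlt
    set x₀ : ℝ := max xε (3 / 2) with hx₀
    have hx₀2 : x₀ < 2 := max_lt hlt (by norm_num)
    have hx₀pos : 0 < x₀ := lt_of_lt_of_le (by norm_num) (le_max_right _ _)
    have hnp : ∀ p : ℕ, p.Prime → (p : ℝ) ≠ x₀ := fun p hp hpx => by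
      have : (2 : ℝ) ≤ p := by exact_mod_cast hp.two_le
      linarith
    have h1 := hi₂ x₀ hx₀pos hnp (le_max_left _ _)
    rw [Chebyshev.theta_eq_zero_of_lt_two hx₀2] at h1
    have : 0 < (1 - ε) * x₀ := mul_pos (by linarith) hx₀pos
    linarith
  have hy2 : 2 ≤ y := hxε2.trans (hxA.le.trans hxAy)
  have hy0 : 0 < y := by linarith
  have hlogy : 0 ≤ Real.log y := Real.log_nonneg (by linarith)
  -- the primes in `[h, y]` and the exceptional ones (those not in `A`)
  set T : Finset ℕ := (primesLE ⌊y⌋₊).filter (fun p => h ≤ (p : ℝ)) with hT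
  set E : Finset ℕ := T.filter (fun p => p ∉ A) with hE
  have hTmem : ∀ p ∈ T, p.Prime ∧ h ≤ (p : ℝ) ∧ (p : ℝ) ≤ y := fun p hp => by
    rw [hT, Finset.mem_filter, mem_primesLE] at hp
    exact ⟨hp.1.2, hp.2, (Nat.cast_le.mpr hp.1.1).trans (Nat.floor_le hy0.le)⟩
  -- if there are at least `M` exceptional primes we are done
  by_cases hM : M ≤ E.card
  · obtain ⟨S, hSE, hScard⟩ := Finset.exists_subset_card_eq hM
    refine ⟨S, hScard, fun p hp => ?_⟩
    have hpE := hSE hp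
    rw [hE, Finset.mem_filter] at hpE
    obtain ⟨hpr, hhp, hpy⟩ := hTmem p hpE.1
    exact ⟨hpr, hpE.2, hhp, hpy⟩
  -- otherwise: at most `M - 1` exceptions, and we derive the printed contradiction
  exfalso
  push Not at hM
  have hEcard : (E.card : ℝ) ≤ M - 1 := by
    have : E.card + 1 ≤ M := hM
    have : (E.card : ℝ) + 1 ≤ M := by exact_mod_cast this
    linarith
  -- (1) `θ(y) ≤ Σ_T log p + θ(h)`
  have hθy : Chebyshev.theta y ≤ ∑ p ∈ T, Real.log p + Chebyshev.theta h := by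
    rw [Chebyshev.theta_eq_sum_primesLE y, Chebyshev.theta_eq_sum_primesLE h]
    rw [← Finset.sum_filter_add_sum_filter_not (primesLE ⌊y⌋₊) (fun p => h ≤ (p : ℝ))]
    have hsub : (primesLE ⌊y⌋₊).filter (fun p : ℕ => ¬h ≤ (p : ℝ)) ⊆ primesLE ⌊h⌋₊ := by
      intro p hp
      rw [Finset.mem_filter, mem_primesLE, not_le] at hp
      rw [mem_primesLE]
      exact ⟨Nat.le_floor hp.2.le, hp.1.2⟩
    have hle := Finset.sum_le_sum_of_subset_of_nonneg hsub (f := fun p : ℕ => Real.log (p : ℝ))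
      (fun p _ _ => Real.log_natCast_nonneg p)
    linarith
  -- (2) `Σ_T log p ≤ x_A + (M-1)·log y`
  have hTsum : ∑ p ∈ T, Real.log p ≤ xA + (M - 1) * Real.log y := by
    rw [← Finset.sum_filter_add_sum_filter_not T (fun p => p ∉ A)]
    have hEsum : ∑ p ∈ E, Real.log p ≤ (M - 1) * Real.log y := by
      calc ∑ p ∈ E, Real.log p ≤ ∑ _p ∈ E, Real.log y := by
            refine Finset.sum_le_sum fun p hp => ?_
            rw [hE, Finset.mem_filter] at hp
            obtain ⟨hpr, -, hpy⟩ := hTmem p hp.1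
            exact Real.log_le_log (by exact_mod_cast hpr.pos) hpy
        _ = E.card * Real.log y := by rw [Finset.sum_const, nsmul_eq_mul]
        _ ≤ (M - 1) * Real.log y := mul_le_mul_of_nonneg_right hEcard hlogy
    have hAsum : ∑ p ∈ T.filter (fun p => ¬p ∉ A), Real.log p ≤ xA := by
      rw [hxA_def]
      refine Finset.sum_le_sum_of_subset_of_nonneg (fun p hp => ?_)
        fun p _ _ => Real.log_natCast_nonneg p
      rw [Finset.mem_filter, not_not] at hp
      exact hp.2
    rw [← hE] 
    linarith
  -- (3) the three analytic inputs at `y` and `h`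
  have hθy_low : (1 - ε) * y < Chebyshev.theta y :=
    theta_gt_of_nonprime (by linarith) hi₂ hy0.le (hxA.le.trans hxAy)
  have hθh : Chebyshev.theta h ≤ 5 / 4 * h + Cε := theta_le_of_nonprime hi₁ hh
  have hlog : (M : ℝ) * Real.log y ≤ ε * y := hii y hy0 (hxA.le.trans hxAy)
  have hlog' : ((M : ℝ) - 1) * Real.log y ≤ ε * y := by nlinarith
  -- (4) the printed chain: `(1-2ε)·y < x_A + 5h/4 + C_ε`, `(1-2ε)(1+6ε) ≥ 1+ε`, `8(1-2ε) ≥ 4`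
  have hchain : (1 - 2 * ε) * y < xA + 5 / 4 * h + Cε := by linarith
  have hcoef : (1 + ε) * xA + 4 * h ≤ (1 - 2 * ε) * y := by
    rw [hy]
    have h1 : 1 + ε ≤ (1 - 2 * ε) * (1 + 6 * ε) := by nlinarith
    have h2 : (4 : ℝ) ≤ 8 * (1 - 2 * ε) := by linarith
    nlinarith
  have hεxA : Cε < ε * xA := hεx.trans_le (by nlinarith [hxA.le])
  linarith

end Literature.NumberTheory.DiophantineGeometry.GenEll
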